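import Summits.BirchSwinnertonDyer.Rank1Residual.ManinAdditive.TwoEisensteinRankOneLaws
import Summits.BirchSwinnertonDyer.BirchSwinnertonDyer.Theorems.ManinLocalTwoThreeOddCongruenceNumber
import Literature.NumberTheory.EllipticCurves.TakahashiDegreeFormulaFromDictionaryProofs
import HarnessLib

/-!
# Placement edges for the leaf `TwoEisensteinRankOneLaws` (imc g15 «2-EISENSTEIN RANK ONE AT LEVEL 4p», rows
# E-imc-81…87, 89, 90): refuter-1's kernel read-back lemmas (REF1 §R58 RB66.1–66.10) and the discharge of the named
# implication E-imc-84 by the THEOREM E-imc-90 — cell `bsd-f2-manin`, typing ask T-imc-8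

Everything here is PROVED and nothing new is asserted: every `theorem` is logic over the leaf's own `def … : Prop`s plus
the tree theorems `…Theorems.ManinLocalTwoThree.OddCongruenceNumberOfIsolationCertificate_holds` (E-imc-90, p626649,
bsd-line-manin23-p3; its file imports only Mathlib, the leaf and Literature — no route `Theses` file, so this module is
outside the theses cone), `ModularParametrizationData.f_mem_integralCuspForms0` (`CongruenceNumber`), the normalisation
inside `IsNewformOf` and `BrandtJL.heckeT_eq_cuspCoeff_smul` (`T_ℓ f = a_ℓ(f) • f` for a newform) — which DISCHARGE three of
the four E-side inputs `FamilyHeckeInputs` (refuter-1 RB66.4), leaving only the PARITY input «`2 ∣ a_ℓ(f_{E'_m})` at an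
odd prime `ℓ ≠ p`» (rational 2-torsion; stated inline below as a hypothesis, not as a new name).  Sources: HOME/ref1-C66-imc-g15-audit.lean 5a8e74af0c7f63eb `section RefAudit66` (refuter-1 g8,
R-imc-33: rc 0 · 0/0/0, axioms `[propext, Classical.choice, Quot.sound]`), copied VERBATIM up to the namespace and the
dropped `RefAudit66.` prefix; the discharge corollaries (`…_of_familyHeckeInputs`, `familyHeckeInputs_of_even_coeff`,
`…_of_even_coeff`, `odd_modularDegree_of_certified_…`) are the typer's short compositions over tree theorems.

WHAT THE EDGES SAY.  (A) `2·S₂(ℤ) ⊆ Nil` (`n = 0` admissible) and the «rank zero» shape (E-imc-81/86) excludes the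
existence half of the «line» shape (E-imc-85) at the same level.  (B) The two spines to Yazdani's expectation E-imc-82:
𝕋-side `E-85 ∧ E-87 ⟹ E-82`; certificate side `E-83 ∧ E-84 ⟹ E-82`, where **E-84 now follows from `FamilyHeckeInputs`
alone** (E-imc-90 is a theorem), so `E-83 ∧ FamilyHeckeInputs ⟹ E-82 ⟹ (ARS, E-imc-89) odd optimal degree`, and
`FamilyHeckeInputs` itself follows from the parity input alone (`familyHeckeInputs_of_even_coeff`), whence
`E-83 ∧ (parity) ⟹ E-82`.  The per-level closing move (one computed certificate ⟹ `r_f` odd at that level) is p3's tree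
theorem `…Theorems.ManinLocalTwoThree.odd_congruenceNumber_of_twoAdicIsolationCertificate` (p627462) and is not repeated
here.  (C) The junk corner `padicValInt 2 0 = 0` is unreachable; `p mod 8` bookkeeping; the
simple-root arithmetic behind refuter-1's F-2.  NO «Manin ⟹ law» edge exists for this leaf: the laws E-imc-81/85/86 are
`c`-free and `E`-free statements about `S₂(Γ₀(N); 𝔽₂)` and are not consequences of `ManinConstantOne`; E-imc-82 is a
statement about `r_f`.  bears_on: stmt-BirchSwinnertonDyer-22967 (C2 `ManinOddAtFour`, stub 6, `RbTotallyBlindTame`).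
PARTITION 0 · beyond-print theorem: no · BSD is not proved by this; Manin's conjecture is not proved by this.
-/

set_option autoImplicit false

noncomputable section

open scoped MatrixGroups
open CongruenceSubgroup
open Literature.NumberTheory.EllipticCurves Literature.NumberTheory.EllipticCurves.ModularForms
open Summit.BirchSwinnertonDyer.BirchSwinnertonDyer.Theorems.ManinLocalTwoThree

namespace Summit.BirchSwinnertonDyer.Rank1Residual.ManinAdditive.TwoEisenstein

/-! ### A. refuter-1's kernel read-back lemmas on the mod-2 vocabulary (REF1 §R58 RB66.1–66.3, VERBATIM up to names) -/

/-- RB66.1 (refuter-1): `n = 0` is admissible in `IsTwoEisensteinNilpotent`, so every twice-integral integral form is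
nilpotent (the nilpotent set always contains `2·S₂(ℤ)`; the laws are statements about its image in `S₂(ℤ)/2`, harmless). -/
theorem isTwoEisensteinNilpotent_of_isTwiceIntegral (N : ℕ) [NeZero N] (g : CuspForm (Gamma0 N) 2)
    (hg : g ∈ integralCuspForms0 N 2) (h2 : IsTwiceIntegral N g) : IsTwoEisensteinNilpotent N g :=
  ⟨hg, fun _ℓ _hℓ _ _ ↦ ⟨0, by rw [pow_zero]; exact h2⟩⟩

/-- RB66.2 (refuter-1): the zero form is twice-integral (degenerate witness: it is `¬ IsTwiceIntegral g₀` in E-imc-85 that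
excludes it). -/
theorem isTwiceIntegral_zero (N : ℕ) : IsTwiceIntegral N (0 : CuspForm (Gamma0 N) 2) :=
  ⟨0, Submodule.zero_mem _, by simp⟩

/-- RB66.3 (refuter-1): a «rank zero» law (shape of E-imc-81 / E-imc-86) at a level is literally the negation of the
EXISTENCE half of the «line» law E-imc-85 at that level — the two shapes cannot both hold at one level, so the residue
conditions `p % 8 = 5` vs `p % 8 = 3` carry content. -/
theorem no_line_of_rank_zero (N : ℕ) [NeZero N]
    (h0 : ∀ g : CuspForm (Gamma0 N) 2, IsTwoEisensteinNilpotent N g → IsTwiceIntegral N g) :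
    ¬ ∃ g₀ : CuspForm (Gamma0 N) 2, IsTwoEisensteinNilpotent N g₀ ∧ ¬ IsTwiceIntegral N g₀ :=
  fun ⟨g₀, h1, h2⟩ ↦ h2 (h0 g₀ h1)

/-! ### B. The two spines to E-imc-82 (REF1 RB66.5–66.7) and the discharge of E-imc-84 by the THEOREM E-imc-90 -/

/-- Level arithmetic of the family: an odd prime `ℓ ≠ p` does not divide `4p` (`p` prime). -/
theorem not_dvd_four_mul_of_odd_prime_ne {ℓ p : ℕ} (hℓ : ℓ.Prime) (hodd : Odd ℓ) (hpp : p.Prime) (hne : ℓ ≠ p) :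
    ¬ ℓ ∣ 4 * p := by
  intro h
  rcases (Nat.Prime.dvd_mul hℓ).mp h with h4 | hp'
  · have h22 : ℓ ∣ 2 ^ 2 := by simpa using h4
    have h2eq : ℓ = 2 := (Nat.prime_dvd_prime_iff_eq hℓ Nat.prime_two).mp (hℓ.dvd_of_dvd_pow h22)
    subst h2eq
    exact absurd hodd (by decide)
  · exact hne ((Nat.prime_dvd_prime_iff_eq hℓ hpp).mp hp')

/-- RB66.5 (refuter-1, kernel-checked modus ponens): **E-imc-90 ∧ `FamilyHeckeInputs` ⟹ E-imc-84**; the only arithmetic is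
`ℓ odd prime, ℓ ≠ p, p prime ⟹ ℓ ∤ 4p`. -/
theorem isolationCertificateForcesOddCongruence_of_E90 (h90 : OddCongruenceNumberOfIsolationCertificate)
    (hin : FamilyHeckeInputs) : IsolationCertificateForcesOddCongruence := by
  intro h83 m p _ D hm hp hpp
  obtain ⟨ℓ, hℓ, a, hodd, hne, ha, hcert⟩ := h83 m p D hm hp hpp
  obtain ⟨hS, h1, hT, h2⟩ := hin m p D ℓ hℓ a hm hp hpp hodd hne ha
  exact h90 (4 * p) ℓ hℓ D.f a hodd (not_dvd_four_mul_of_odd_prime_ne hℓ hodd hpp hne) hS h1 hT h2 hcert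

/-- **E-imc-84 modulo the E-side inputs, UNCONDITIONALLY in E-imc-90**: since E-imc-90 is a THEOREM
(`…Theorems.ManinLocalTwoThree.OddCongruenceNumberOfIsolationCertificate_holds`, p626649), the named implication
`IsolationCertificateForcesOddCongruence` (E-imc-83 → E-imc-82) follows from `FamilyHeckeInputs` alone. -/
theorem isolationCertificateForcesOddCongruence_of_familyHeckeInputs (hin : FamilyHeckeInputs) :
    IsolationCertificateForcesOddCongruence :=
  isolationCertificateForcesOddCongruence_of_E90 OddCongruenceNumberOfIsolationCertificate_holds hin

/-- RB66.6 (refuter-1): the 𝕋-side spine is two modus ponens steps: E-imc-85 ∧ E-imc-87 ⟹ E-imc-82 (then E-imc-89 gives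
odd optimal degree). -/
theorem fourPFamilyCongruenceOdd_of_rankOne (h85 : FourPTwoEisensteinRankOne) (h87 : RankOneForcesOddCongruence) :
    FourPFamilyCongruenceOdd := h87 h85

/-- RB66.7 (refuter-1): the certificate spine: E-imc-83 ∧ E-imc-84 ⟹ E-imc-82. -/
theorem fourPFamilyCongruenceOdd_of_certificates (h83 : FourPFamilyIsolationCertified)
    (h84 : IsolationCertificateForcesOddCongruence) : FourPFamilyCongruenceOdd := h84 h83

/-- The certificate spine with E-imc-84 discharged: **E-imc-83 ∧ `FamilyHeckeInputs` ⟹ E-imc-82** (Yazdani's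
expectation on the whole family), unconditionally in E-imc-90. -/
theorem fourPFamilyCongruenceOdd_of_certified_of_familyHeckeInputs (h83 : FourPFamilyIsolationCertified)
    (hin : FamilyHeckeInputs) : FourPFamilyCongruenceOdd :=
  fourPFamilyCongruenceOdd_of_certificates h83 (isolationCertificateForcesOddCongruence_of_familyHeckeInputs hin)

/-- The certificate spine composed with the kernel edge E-imc-89: **E-imc-83 ∧ `FamilyHeckeInputs` ∧ ARS Thm 2.1 ⟹ odd
OPTIMAL modular degree** for every degree-minimal `X₀(4p)`-datum of `E'_m` (the input of an's parity row E-an-74 and, via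
ČNS Thm 1.2, of C2 on the blind tame family). -/
theorem odd_modularDegree_of_certified_of_familyHeckeInputs (h83 : FourPFamilyIsolationCertified)
    (hin : FamilyHeckeInputs) (hARS : modularDegree_dvd_congruenceNumber) (m : ℤ) (p : ℕ) [NeZero (4 * p)]
    [(⟨0, -2 * (m : ℚ), 0, (p : ℚ), 0⟩ : WeierstrassCurve ℚ).IsElliptic]
    (D : ModularParametrizationData (⟨0, -2 * (m : ℚ), 0, (p : ℚ), 0⟩ : WeierstrassCurve ℚ) (4 * p))
    (hm : m % 4 = 1) (hp : (p : ℤ) = m ^ 2 + 4) (hpp : p.Prime)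
    (hmin : ∀ (W' : WeierstrassCurve ℚ) [W'.IsElliptic] (D' : ModularParametrizationData W' (4 * p)),
      D'.f = D.f → D.modularDegree ≤ D'.modularDegree) :
    Odd D.modularDegree :=
  odd_modularDegree_of_congruenceOdd (fourPFamilyCongruenceOdd_of_certified_of_familyHeckeInputs h83 hin) hARS m p D
    hm hp hpp hmin

/-- **Three of the four E-side inputs are tree theorems**: for the family datum `D`, `D.f ∈ S₂(ℤ)`
(`ModularParametrizationData.f_mem_integralCuspForms0`), `a₁(D.f) = 1` (the normalisation inside `D.isNewformOf`) and
`T_ℓ D.f = a_ℓ • D.f` (`BrandtJL.heckeT_eq_cuspCoeff_smul`, Atkin–Lehner Thm 3) hold for EVERY datum; so `FamilyHeckeInputs`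
follows from the PARITY input alone — «`a_ℓ(f_{E'_m})` is even at every odd prime `ℓ ≠ p`» (the rational 2-torsion point
`(0, 0)` of `E'_m`; not yet a tree theorem, taken here as an inline hypothesis). -/
theorem familyHeckeInputs_of_even_coeff
    (hpar : ∀ (m : ℤ) (p : ℕ) [NeZero (4 * p)]
      (D : ModularParametrizationData (⟨0, -2 * (m : ℚ), 0, (p : ℚ), 0⟩ : WeierstrassCurve ℚ) (4 * p))
      (ℓ : ℕ) (a : ℤ), m % 4 = 1 → (p : ℤ) = m ^ 2 + 4 → p.Prime → ℓ.Prime → Odd ℓ → ℓ ≠ p →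
        (a : ℂ) = cuspCoeff D.f ℓ → (2 : ℤ) ∣ a) :
    FamilyHeckeInputs := by
  intro m p _ D ℓ hℓ a hm hp hpp hodd hne ha
  refine ⟨D.f_mem_integralCuspForms0, (isNormalized_iff_cuspCoeff_one D.f).mp D.isNewformOf.1.2.2, ?_,
    hpar m p D ℓ a hm hp hpp hℓ hodd hne ha⟩
  rw [BrandtJL.heckeT_eq_cuspCoeff_smul D.isNewformOf.1 hℓ, ← ha]

/-- **E-imc-84 from the parity input alone** (E-imc-90 is a theorem; three inputs discharged above). -/
theorem isolationCertificateForcesOddCongruence_of_even_coeff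
    (hpar : ∀ (m : ℤ) (p : ℕ) [NeZero (4 * p)]
      (D : ModularParametrizationData (⟨0, -2 * (m : ℚ), 0, (p : ℚ), 0⟩ : WeierstrassCurve ℚ) (4 * p))
      (ℓ : ℕ) (a : ℤ), m % 4 = 1 → (p : ℤ) = m ^ 2 + 4 → p.Prime → ℓ.Prime → Odd ℓ → ℓ ≠ p →
        (a : ℂ) = cuspCoeff D.f ℓ → (2 : ℤ) ∣ a) :
    IsolationCertificateForcesOddCongruence :=
  isolationCertificateForcesOddCongruence_of_familyHeckeInputs (familyHeckeInputs_of_even_coeff hpar)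

/-- **E-imc-83 ∧ (parity) ⟹ E-imc-82**: on the blind tame family, a 2-adic isolation certificate at every level plus the
evenness of `a_ℓ(f_{E'_m})` at the certifying prime give Yazdani's expectation for ALL `m` — unconditionally in E-imc-90
and in the three discharged inputs. -/
theorem fourPFamilyCongruenceOdd_of_certified_of_even_coeff (h83 : FourPFamilyIsolationCertified)
    (hpar : ∀ (m : ℤ) (p : ℕ) [NeZero (4 * p)]
      (D : ModularParametrizationData (⟨0, -2 * (m : ℚ), 0, (p : ℚ), 0⟩ : WeierstrassCurve ℚ) (4 * p))
      (ℓ : ℕ) (a : ℤ), m % 4 = 1 → (p : ℤ) = m ^ 2 + 4 → p.Prime → ℓ.Prime → Odd ℓ → ℓ ≠ p →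
        (a : ℂ) = cuspCoeff D.f ℓ → (2 : ℤ) ∣ a) :
    FourPFamilyCongruenceOdd :=
  fourPFamilyCongruenceOdd_of_certificates h83 (isolationCertificateForcesOddCongruence_of_even_coeff hpar)

/-! ### C. Corners and arithmetic (REF1 RB66.8–66.10) -/

/-- RB66.8 (refuter-1; junk corner, not exploitable): `padicValInt 2 0 = 0`, so a certificate with `a = 1 + ℓ` would read
«`z` odd»; but then `0 = 1 + ℓ − a` is an eigenvalue of `(1+ℓ) − T_ℓ` on `f`, the determinant is `0`, and `z ≠ 0` fails. -/
example : padicValInt 2 0 = 0 := by simp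

/-- RB66.9 (refuter-1; residue bookkeeping): `p ≡ 5 (mod 8) ⟹ p ≡ 1 (mod 4)` and `p ≡ 3 (mod 8) ⟹ p ≡ 3 (mod 4)`
(E-imc-85's class sits inside E-imc-88's existence class, E-imc-86's inside its non-existence class). -/
example (p : ℕ) (h : p % 8 = 5) : p % 4 = 1 := by omega
example (p : ℕ) (h : p % 8 = 3) : p % 4 = 3 := by omega

/-- RB66.10 (refuter-1; the simple-root arithmetic behind F-2 / E-imc-90): if the characteristic polynomial of `T_ℓ` on
`S₂` factors as `(x - a)^m · q` with `q(a) ≠ 0`, the certificate `v₂(det((1+ℓ) - T_ℓ)) = v₂(1+ℓ-a)` reads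
`m · v + w = v` with `v = v₂(1+ℓ-a) ≥ 1` (`a` even, `ℓ` odd), `w = v₂(q(1+ℓ)) ≥ 0`, `m ≥ 1` (`f` is an
`a`-eigenvector): hence `m = 1` (the eigenvalue `a` is SIMPLE) and `w = 0`. -/
theorem simple_root_arith (m v w : ℕ) (hm : 1 ≤ m) (hv : 1 ≤ v) (h : m * v + w = v) :
    m = 1 ∧ w = 0 := by
  have h1 : v ≤ m * v := Nat.le_mul_of_pos_left v hm
  refine ⟨?_, by omega⟩
  have h2 : m * v = 1 * v := by omega
  exact Nat.eq_of_mul_eq_mul_right hv h2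

end Summit.BirchSwinnertonDyer.Rank1Residual.ManinAdditive.TwoEisenstein

end
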